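import Mathlib
import Summits.QuantumFields.YangMills.Theorems.EguchiKawaiDirectionLadderHaarEntrywiseRigidity
import HarnessLib

/-!
# Entrywise rigidity for two independent Haar unitaries («the RMT fact twice»)

For the Eguchi–Kawai a-priori measure `ekHaar 2 N = Haar ⊗ Haar` on pairs `(U₁, U₂)` and column-monotone
sub-diagonal weights `x_{jk} ≥ 0` (as in `haar_measure_entrywise_le`), the event that the TOTAL weighted
sub-diagonal mass of the two matrices is at most `N t` has probability at most
`(e^{8N²} ∏_{k<j} (1 + x_{jk}/t)⁻¹)²` (`ekHaar_two_measure_entrywise_le`): each matrix separately has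
mass `≤ N t`, and the product measure of a product set is the product.  This is the form in which the
generic-region count enters the triple problem (stub plan A1 of crux `TripleSmallBallMargin`, route
`EguchiKawaiDirectionLadder`: rigidity of `U₁` AND `U₂` in the eigenbasis of `U₀`).  [folklore]
-/

noncomputable section

open MeasureTheory Finset
open Literature.Barriers.QuantumFields
open Literature.MathematicalPhysics.QuantumFieldTheory (haarProbability)
open scoped ENNReal

namespace Summit.QuantumFields.YangMills.Theorems.EguchiKawaiDirectionLadder.HaarColumns

/-- **Entrywise rigidity for a pair of independent Haar unitaries.** [folklore] -/
theorem ekHaar_two_measure_entrywise_le {N : ℕ} (x : Fin N → Fin N → ℝ) (hx : ∀ j k, 0 ≤ x j k)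
    (hmono : ∀ j k l : Fin N, l ≤ k → k < j → x j k ≤ x j l) {t : ℝ} (ht : 0 < t) :
    ekHaar 2 N {U : EKConfig 2 N | ∑ μ : Fin 2, ∑ k, ∑ j,
        (if k < j then x j k * ‖(U μ : Matrix (Fin N) (Fin N) ℂ) j k‖ ^ 2 else 0) ≤ N * t} ≤
      ENNReal.ofReal ((Real.exp (8 * (N : ℝ) ^ 2) *
        ∏ k : Fin N, ∏ j : Fin N, (if k < j then (1 + x j k / t)⁻¹ else 1)) ^ 2) := by
  set E : Set (UN N) := {W : UN N | ∑ k, ∑ j,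
      (if k < j then x j k * ‖(W : Matrix (Fin N) (Fin N) ℂ) j k‖ ^ 2 else 0) ≤ N * t} with hE
  set B : ℝ := Real.exp (8 * (N : ℝ) ^ 2) *
      ∏ k : Fin N, ∏ j : Fin N, (if k < j then (1 + x j k / t)⁻¹ else 1) with hB
  have hB0 : 0 ≤ B := by
    refine mul_nonneg (Real.exp_pos _).le (Finset.prod_nonneg fun k _ => Finset.prod_nonneg fun j _ => ?_)
    split_ifs
    · have := hx j k; positivity
    · exact zero_le_one
  have hone : haarProbability (UN N) E ≤ ENNReal.ofReal B := haar_measure_entrywise_le x hx hmono ht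
  -- each matrix separately has mass at most `N t`
  have hnn : ∀ (U : EKConfig 2 N) (μ : Fin 2), 0 ≤ ∑ k, ∑ j,
      (if k < j then x j k * ‖(U μ : Matrix (Fin N) (Fin N) ℂ) j k‖ ^ 2 else 0) := by
    intro U μ
    refine Finset.sum_nonneg fun k _ => Finset.sum_nonneg fun j _ => ?_
    split_ifs
    · exact mul_nonneg (hx j k) (by positivity)
    · exact le_refl _
  have hsub : {U : EKConfig 2 N | ∑ μ : Fin 2, ∑ k, ∑ j,
        (if k < j then x j k * ‖(U μ : Matrix (Fin N) (Fin N) ℂ) j k‖ ^ 2 else 0) ≤ N * t} ⊆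
      Set.pi Set.univ (fun _ : Fin 2 => E) := by
    intro U hU
    rw [Set.mem_setOf_eq] at hU
    intro μ _
    rw [hE, Set.mem_setOf_eq]
    exact le_trans (Finset.single_le_sum (fun μ' _ => hnn U μ') (Finset.mem_univ μ)) hU
  calc ekHaar 2 N {U : EKConfig 2 N | ∑ μ : Fin 2, ∑ k, ∑ j,
          (if k < j then x j k * ‖(U μ : Matrix (Fin N) (Fin N) ℂ) j k‖ ^ 2 else 0) ≤ N * t}
      ≤ ekHaar 2 N (Set.pi Set.univ (fun _ : Fin 2 => E)) := measure_mono hsub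
    _ = ∏ _μ : Fin 2, haarProbability (UN N) E := by
        rw [ekHaar, Measure.pi_pi]
    _ ≤ ∏ _μ : Fin 2, ENNReal.ofReal B := Finset.prod_le_prod' fun μ _ => hone
    _ = ENNReal.ofReal (B ^ 2) := by
        rw [Finset.prod_const, Finset.card_univ, Fintype.card_fin, ENNReal.ofReal_pow hB0]

end Summit.QuantumFields.YangMills.Theorems.EguchiKawaiDirectionLadder.HaarColumns

end
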